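import Mathlib
import HarnessLib
import Literature.Analysis.FluidPDE.VectorCalculus
import Summits.NavierStokesRegularity.NavierStokesRegularity.Theorems.UnthreadedRigidityDoorUnthreadedRigidityVirialHornAngularJets
import Summits.NavierStokesRegularity.NavierStokesRegularity.Theorems.UnthreadedRigidityDoorUnthreadedRigidityCoZonalSupports

/-!
# W2 door `UnthreadedRigidity` — LINE g12-1 «CO-ZONAL»: support CZ-b `ZonalAxesMatch`

engine-1 g71 (KEY-NS #205 (b)).  Two nonzero zonal solid harmonics of positive degree, with axes `a` and `b`, that
Poisson-commute (`{Y₁,Y₂} = det[y,∇Y₁,∇Y₂] ≡ 0`) have a common axis: `Y₂` is zonal about `a`.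

Proof.  If `a × b = 0` the axes are proportional and zonality about `b` is zonality about `a`.  If `a × b ≠ 0` the
hypotheses are contradictory: by LEMMA R (`IsSolidHarmonic.eq_zero_of_rot_eventuallyEq_zero`) the rotation fields
`Rᵢ = y × ∇Yᵢ` of nonzero harmonics do not vanish on any nonempty open set, so there is a point `y` off the plane of the
axes (`D = det[y,a,b] ≠ 0`) with `R₁ ≠ 0 ≠ R₂`.  Resolving in the reciprocal frame of `(y,a,b)`,
`D R₁ = ⟪R₁,b⟫ (y × a)` and `D R₂ = ⟪R₂,a⟫ (b × y)` (the other components vanish by `Rᵢ ⊥ y` and zonality), whence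
`⟪R₁,b⟫ ≠ 0 ≠ ⟪R₂,a⟫` and `D {Y₁,Y₂}(y) = −⟪R₁,b⟫⟪R₂,a⟫ ≠ 0` — contradicting `{Y₁,Y₂} ≡ 0`.

LABEL: support lemma of a MODEL line (W2 door, item 27585 OPEN); elementary vector algebra + LEMMA R; not a statement about
the Navier–Stokes equations.  0 kit.
-/

-- the summit and its single sub-problem share the name (CONVENTIONS §1), as in every Theorems file
set_option linter.dupNamespace false

namespace Summit.NavierStokesRegularity.NavierStokesRegularity.Theorems.UnthreadedRigidity.CoZonal

open scoped Topology InnerProductSpace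
open Filter Set
open Literature.Analysis.FluidPDE (cross)
open Summit.NavierStokesRegularity.NavierStokesRegularity.Theorems.UnthreadedRigidity.VirialHorn
open Summit.NavierStokesRegularity.NavierStokesRegularity.Theorems.UnthreadedRigidity.ProfileHorn (E3)

/-! ## Coordinates (private copies, as in the other files of this door) -/

/-- components of the cross product. -/
private theorem cross_apply_zero (u v : E3) : cross u v 0 = u 1 * v 2 - u 2 * v 1 := by simp [cross, cross_apply]

/-- components of the cross product. -/
private theorem cross_apply_one (u v : E3) : cross u v 1 = u 2 * v 0 - u 0 * v 2 := by simp [cross, cross_apply]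

/-- components of the cross product. -/
private theorem cross_apply_two (u v : E3) : cross u v 2 = u 0 * v 1 - u 1 * v 0 := by simp [cross, cross_apply]

/-- the inner product in coordinates. -/
private theorem real_inner_e3 (u v : E3) : ⟪u, v⟫_ℝ = u 0 * v 0 + u 1 * v 1 + u 2 * v 2 := by
  simp [PiLp.inner_apply, Fin.sum_univ_three, mul_comm]

/-- `u × (v × w) = ⟪u,w⟫ v − ⟪u,v⟫ w`. -/
private theorem cross_cross_eq (u v w : E3) : cross u (cross v w) = ⟪u, w⟫_ℝ • v - ⟪u, v⟫_ℝ • w := by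
  ext i
  fin_cases i <;> simp [cross_apply_zero, cross_apply_one, cross_apply_two, real_inner_e3] <;> ring

/-- parallel vectors from a vanishing cross product: `X × Z = 0 ⇒ ‖Z‖² X = ⟪Z, X⟫ Z`. -/
private theorem smul_eq_of_cross_eq_zero {X Z : E3} (h : cross X Z = 0) : ⟪Z, Z⟫_ℝ • X = ⟪Z, X⟫_ℝ • Z := by
  have := cross_cross_eq Z X Z
  rw [h] at this
  have h0 : cross Z (0 : E3) = 0 := by
    ext i; fin_cases i <;> simp [cross_apply_zero, cross_apply_one, cross_apply_two]
  rw [h0] at this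
  exact (sub_eq_zero.mp this.symm)

/-- RESOLUTION IN THE RECIPROCAL FRAME of three vectors: `det[y,a,b] v = ⟪v,y⟫ (a × b) + ⟪v,a⟫ (b × y) + ⟪v,b⟫ (y × a)`
(an exact polynomial identity; for `det[y,a,b] ≠ 0` it expands `v` in the basis dual to `(y,a,b)`). -/
theorem triad_resolution (y a b v : E3) :
    det3 y a b • v = ⟪v, y⟫_ℝ • cross a b + ⟪v, a⟫_ℝ • cross b y + ⟪v, b⟫_ℝ • cross y a := by
  ext i
  fin_cases i <;>
    simp only [real_inner_e3, PiLp.add_apply, PiLp.smul_apply, smul_eq_mul, det3] <;>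
      simp [cross_apply_zero, cross_apply_one, cross_apply_two] <;> ring

/-! ## Density of the rotation field's support (from LEMMA R) -/

/-- a nonzero solid harmonic of degree `≥ 1` has `y × ∇Y(y) ≠ 0` somewhere in every nonempty open set
(contrapositive of LEMMA R `IsSolidHarmonic.eq_zero_of_rot_eventuallyEq_zero`). -/
theorem exists_rot_ne_zero_of_isOpen {l : ℕ} {Y : E3 → ℝ} (hY : IsSolidHarmonic l Y) (hl : 1 ≤ l)
    (hne : ∃ y, Y y ≠ 0) {V : Set E3} (hV : IsOpen V) (hVne : V.Nonempty) :
    ∃ y ∈ V, cross y (gradient Y y) ≠ 0 := by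
  by_contra h
  obtain ⟨y₀, hy₀⟩ := hVne
  obtain ⟨y₁, hy₁⟩ := hne
  have hev : ∀ᶠ y in 𝓝 y₀, cross y (gradient Y y) = 0 := by
    filter_upwards [hV.mem_nhds hy₀] with y hy
    by_contra hy'
    exact h ⟨y, hy, hy'⟩
  exact hy₁ (IsSolidHarmonic.eq_zero_of_rot_eventuallyEq_zero hY hl hev y₁)

/-- the rotation field `y ↦ y × ∇Y(y)` of a solid harmonic is continuous. -/
theorem continuous_rot {l : ℕ} {Y : E3 → ℝ} (hY : IsSolidHarmonic l Y) :
    Continuous fun y : E3 => cross y (gradient Y y) :=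
  continuous_iff_continuousAt.2 fun y => (hY.hasFDerivAt_rot y).continuousAt

/-! ## CZ-b -/

/-- ★ SUPPORT CZ-b «AXES MATCH» (`ZonalAxesMatch`, LINE g12-1 CO-ZONAL, ns-idea-6 `CoZonal_sketch` c7eabdeb25f1685c):
two nonzero zonal solid harmonics of positive degree that Poisson-commute share the axis.  (Parallel axes: trivial.  Skew axes:
at a point off the plane of the axes where both rotation fields are nonzero — such points exist by LEMMA R — the reciprocal-frame
resolution gives `det[y,a,b]·{Y₁,Y₂}(y) = −⟪y × ∇Y₁, b⟫⟪y × ∇Y₂, a⟫ ≠ 0`.) -/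
theorem zonalAxesMatch_holds : ZonalAxesMatch := by
  intro l₁ l₂ Y₁ Y₂ a b hl₁ hl₂ hY₁ hY₂ hne₁ hne₂ _ha hb hza hzb hP
  by_cases hab : cross a b = 0
  · -- parallel axes: `‖b‖² a = ⟪b,a⟫ b`, and `det3` is linear in its first slot
    have hsm := smul_eq_of_cross_eq_zero hab
    have hbb : ⟪b, b⟫_ℝ ≠ 0 := (real_inner_self_pos.2 hb).ne'
    intro y
    have h1 : ⟪b, b⟫_ℝ * det3 a y (gradient Y₂ y) = ⟪b, a⟫_ℝ * det3 b y (gradient Y₂ y) := by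
      rw [det3_eq_inner_cross a y, det3_eq_inner_cross b y, ← real_inner_smul_left, ← real_inner_smul_left, hsm]
    rw [hzb y, mul_zero] at h1
    exact (mul_eq_zero.1 h1).resolve_left hbb
  · -- skew axes are contradictory
    exfalso
    -- the open set off the plane of the axes
    have hDcont : Continuous fun y : E3 => det3 y a b := by
      have : (fun y : E3 => det3 y a b) = fun y => ⟪y, cross a b⟫_ℝ := funext fun y => det3_eq_inner_cross y a b
      rw [this]
      exact continuous_id.inner continuous_const
    have hSopen : IsOpen {y : E3 | det3 y a b ≠ 0} := isOpen_ne_fun hDcont continuous_const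
    have hSne : ({y : E3 | det3 y a b ≠ 0}).Nonempty := by
      refine ⟨cross a b, ?_⟩
      rw [Set.mem_setOf_eq, det3_eq_inner_cross]
      exact (real_inner_self_pos.2 hab).ne'
    -- a point with all three non-degeneracies
    obtain ⟨y₁, hy₁S, hy₁R⟩ := exists_rot_ne_zero_of_isOpen hY₁ hl₁ hne₁ hSopen hSne
    have hS₁open : IsOpen ({y : E3 | det3 y a b ≠ 0} ∩ {y : E3 | cross y (gradient Y₁ y) ≠ 0}) :=
      hSopen.inter (isOpen_ne_fun (continuous_rot hY₁) continuous_const)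
    obtain ⟨y, ⟨hyD, hyR₁⟩, hyR₂⟩ :=
      exists_rot_ne_zero_of_isOpen hY₂ hl₂ hne₂ hS₁open ⟨y₁, hy₁S, hy₁R⟩
    rw [Set.mem_setOf_eq] at hyD hyR₁
    -- orthogonality relations of the rotation fields
    have hR₁y : ⟪cross y (gradient Y₁ y), y⟫_ℝ = 0 := by
      rw [real_inner_comm, ← det3_eq_inner_cross y y (gradient Y₁ y)]; simp only [det3]; ring
    have hR₁a : ⟪cross y (gradient Y₁ y), a⟫_ℝ = 0 := by
      rw [real_inner_comm, ← det3_eq_inner_cross a y (gradient Y₁ y)]; exact hza y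
    have hR₂y : ⟪cross y (gradient Y₂ y), y⟫_ℝ = 0 := by
      rw [real_inner_comm, ← det3_eq_inner_cross y y (gradient Y₂ y)]; simp only [det3]; ring
    have hR₂b : ⟪cross y (gradient Y₂ y), b⟫_ℝ = 0 := by
      rw [real_inner_comm, ← det3_eq_inner_cross b y (gradient Y₂ y)]; exact hzb y
    -- resolutions in the reciprocal frame of `(y,a,b)`
    have hres₁ : det3 y a b • cross y (gradient Y₁ y) = ⟪cross y (gradient Y₁ y), b⟫_ℝ • cross y a := by
      have := triad_resolution y a b (cross y (gradient Y₁ y))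
      rw [hR₁y, hR₁a, zero_smul, zero_smul, zero_add, zero_add] at this
      exact this
    have hres₂ : det3 y a b • cross y (gradient Y₂ y) = ⟪cross y (gradient Y₂ y), a⟫_ℝ • cross b y := by
      have := triad_resolution y a b (cross y (gradient Y₂ y))
      rw [hR₂y, hR₂b, zero_smul, zero_smul, zero_add, add_zero] at this
      exact this
    -- the surviving coefficients are nonzero
    have hc₁ : ⟪cross y (gradient Y₁ y), b⟫_ℝ ≠ 0 := by
      intro h0
      rw [h0, zero_smul] at hres₁
      exact hyR₁ ((smul_eq_zero.1 hres₁).resolve_left hyD)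
    have hc₂ : ⟪cross y (gradient Y₂ y), a⟫_ℝ ≠ 0 := by
      intro h0
      rw [h0, zero_smul] at hres₂
      exact hyR₂ ((smul_eq_zero.1 hres₂).resolve_left hyD)
    -- the bracket at `y`
    have hflip : ⟪cross y a, gradient Y₂ y⟫_ℝ = -⟪cross y (gradient Y₂ y), a⟫_ℝ := by
      rw [← det3_eq_inner_cross_left y a (gradient Y₂ y), real_inner_comm, ← det3_eq_inner_cross a y (gradient Y₂ y)]
      simp only [det3]; ring
    have hkey : det3 y a b * pbr Y₁ Y₂ y = -(⟪cross y (gradient Y₁ y), b⟫_ℝ * ⟪cross y (gradient Y₂ y), a⟫_ℝ) := by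
      simp only [pbr]
      rw [det3_eq_inner_cross_left y (gradient Y₁ y) (gradient Y₂ y), ← real_inner_smul_left, hres₁, real_inner_smul_left,
        hflip]
      ring
    rw [hP y, mul_zero] at hkey
    exact mul_ne_zero hc₁ hc₂ (neg_eq_zero.1 hkey.symm)

end Summit.NavierStokesRegularity.NavierStokesRegularity.Theorems.UnthreadedRigidity.CoZonal
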